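import Summits.QuantumFields.BalabanUV.Beta.GAN24.FaceWordCellPairingDeep
import Summits.QuantumFields.BalabanUV.Beta.GAN24.FaceWordEEDiagZero

/-!
# `BalabanUV.Beta.GAN24.FaceWordEEZero` — binder row G-an2-4 ∕ (CONV-C), W-slot (α-0), typer's PART VI row **T6-VAL**, the (γ) hand's letter **K7-0, ASSEMBLED FOR THE E SECTOR AT
# LEVEL `0`**: **leaf-02 Part 45's OUTPUT WORD FOR road-P2's UNIT-SCALED LEVEL-`0` E-SECTOR TABLE `S^E_0 = unitS sf sm (cE • wilsonA d)` THROUGH `X̃♮_0` AT THE DEEP PERIOD `Lc·N`, VALUED** —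
# `Σ_{rr∈box(Lc·N)} Σ'_t χ(rr_μ)χ(t_ν)·Σ'_{(y,w)} χ(y_α)χ(w_β)·((S^E_0 μ rr ∘ X̃♮_0) ∘ S^E_0 ν t)(y,w)(inl α)(inl β)
#   = K_E²·(−½)(½)·sf²·( wVH_0⁻¹·⟨q^{(Lc·N)}_{μα}, E2_0 q^{(Lc·N)}_{νβ}⟩_{box(Lc·N)} − wVH_0⁻¹·Lc^{d+1}·Lc^{d+1}·⟨q^{(N)}_{μα}, E2_1 q^{(N)}_{νβ}⟩_{box N} )`,
# `K_E = (sf·sm)⁻¹·sf⁻²·cE` (`μ ≠ α`, `ν ≠ β`; every `d`, in-block root, all units, every `N ≥ 1`), and `= 0` on the diagonal patterns `ν = β` ∕ `μ = α`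
# — g56's `FaceWordEEDeep.faceWordEE_deep_value` with `j + 1 ↦ 0`: this seat's junction `FaceWordCellPairingDeep.faceWord_eq_cellPairing` (generic `S`, `X`) ⨾ `FaceWordEEValueZero` ∕
# `FaceWordEEDiagZero`, the admissibility of `(S^E_0, X̃♮_0)` discharged from an2's `StepJetData.locStencil_wilsonA ∕ wilsonA_translate`
# (G-an2-4 CRUX TEAM (2), seat `b2b-balaban-gan24-formalise-leaf-06` = the (γ) hand, gen 57; journal [GAN24LEAF06-G57-INTENT-1])

NOT IN PRINT; OUR BOOKKEEPING ([folklore] bookkeeping BY NAME: an2's `StepJetData.locStencil_wilsonA ∕ wilsonA_translate ∕ locStencil_smul`, `HessKerDressedUnits.locStencil_unitS ∕ decays_unitK ∕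
unitS_apply`, `AxialDressingRooted.decays_coDressKBmAt_KInvStep` (at `j = 0`), leaf-04's `EEWordReduced.shiftK_dressedStep` (at `j = 0`), `BalabanStepJets.locStencil_mono`,
`OneStepResolventKernel.decays_mono`; 0 `def`, 0 cited fact, 0 `def … : Prop`, 0 sorry).
HONEST FRAMING (cell contract, verbatim): «discharging `BetaPertH` makes Bałaban's UV stability UNCONDITIONAL — a real constructive-QFT result; it is NOT the continuum
limit and NOT the Clay problem.»  HONEST DEPENDENCY (verbatim): «continuum YM on T⁴ ⇐ BetaPertH ∧ nine spine estimates (0/9 proved); BetaPertH ⇐ (D1) ∧ (D4) ∧ CAP+tail;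
G-an2-4 gates asym, D1 and NE2/3/4.»

WHAT ([folklore]): §1 admissibility of `(S^E_0, X̃♮_0)` at a common rate — `sectorE0_inr_left ∕ sectorE0_inr_right` (field legs only), `sectorE0_translate` (fine covariance of the slot),
`exists_common_rate0`, `dressedStep_invariant_deep0`; §2 **`faceWordEE_zero_value`** (the display), `faceWordEE_zero_eq_zero_of_right_diag ∕ _of_left_diag`.
Asserts NO value of Bałaban's tables beyond this identity; the E⊗VH ∕ VH⊗E ∕ VH⊗VH ∕ multiplier ∕ W face words of the level-`0` face read, the swapped word, and the `LS`-assembly into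
road-P2's `FFsym` literal are NOT here; discharges NOTHING of `hX` ∕ `hXu` ∕ (C)_{≥1} ∕ `hB0` ∕ `hBF` ∕ (Q-L); NEVER «G-an2-4 closed» as (CONV-C); NOT D1, NOT `BetaPertH`, NOT continuum,
NOT Clay.  2026-08-24; no existing file touched.
-/

noncomputable section

open Finset
open scoped BigOperators
open Literature.MathematicalPhysics.QuantumFieldTheory
open Literature.MathematicalPhysics.QuantumFieldTheory.Balaban1983to89
open Literature.MathematicalPhysics.QuantumFieldTheory.Balaban1983to89.Beta
open ExpKernelCalculus (Site MKer Decays BiLoc shiftK comp)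
open OneStepResolventKernel (Fib LocStencil decays_mono)
open OneStepKernelFamily (KInvStep)
open BalabanStepJets (locStencil_mono)
open StepJetData (wilsonA locStencil_wilsonA wilsonA_translate locStencil_smul)
open AffineAveraging (box toSite)
open BalabanStepJetsSucc (E2 wVH)
open Summit.QuantumFields.BalabanUV.Beta.AxialDressingRooted (coDressKBmAt one_le_of_neZero decays_coDressKBmAt_KInvStep)
open Summit.QuantumFields.BalabanUV.Beta.HessKerDressedUnits (unitK unitS unitS_apply locStencil_unitS decays_unitK)
open Summit.QuantumFields.BalabanUV.Beta.GAN24.EEWordReduced (shiftK_dressedStep)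
open Summit.QuantumFields.BalabanUV.Beta.GAN24.FaceWordCellPairingDeep (faceWord_eq_cellPairing)
open Summit.QuantumFields.BalabanUV.Beta.GAN24.FaceWordEEValueZero (cellPairing_zero_value_units)
open Summit.QuantumFields.BalabanUV.Beta.GAN24.FaceWordEEDiagZero (cellPairing_zero_eq_zero_of_right_diag_units cellPairing_zero_eq_zero_of_left_diag_units)

namespace Summit.QuantumFields.BalabanUV.Beta.GAN24.FaceWordEEZero

variable {d : ℕ} {Lc : ℕ} [NeZero Lc] {r : Fin (d + 1) → ℕ}

/-! ## §1 Admissibility of road-P2's level-`0` E-sector table and dressed step kernel at a common rate -/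

omit [NeZero Lc] in
/-- [folklore] **FIELD LEGS ONLY, FIRST LEG**: the unit-scaled level-`0` E-sector table has no multiplier first leg. -/
theorem sectorE0_inr_left (sf sm cE : ℝ) (κ : Fin (d + 1)) (t y x : Site (d + 1)) (m : Fin (d + 1)) (b : Fib d) :
    unitS sf sm (fun κ u => cE • wilsonA d κ u) κ t y x (Sum.inr m) b = 0 := by
  rw [unitS_apply]
  simp only [Pi.smul_apply, smul_eq_mul]
  cases b <;> simp [StepJetData.wilsonA]

omit [NeZero Lc] in
/-- [folklore] **FIELD LEGS ONLY, SECOND LEG**: the unit-scaled level-`0` E-sector table has no multiplier second leg. -/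
theorem sectorE0_inr_right (sf sm cE : ℝ) (κ : Fin (d + 1)) (t y x : Site (d + 1)) (a : Fib d) (m : Fin (d + 1)) :
    unitS sf sm (fun κ u => cE • wilsonA d κ u) κ t y x a (Sum.inr m) = 0 := by
  rw [unitS_apply]
  simp only [Pi.smul_apply, smul_eq_mul]
  cases a <;> simp [StepJetData.wilsonA]

omit [NeZero Lc] in
/-- [folklore] **FINE COVARIANCE OF THE SLOT** of the unit-scaled level-`0` E-sector table (`wilsonA_translate` through `unitS_apply`): `S^E_0 κ (t + v) = shiftK (−v) (S^E_0 κ t)`. -/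
theorem sectorE0_translate (sf sm cE : ℝ) (κ : Fin (d + 1)) (t v : Site (d + 1)) :
    unitS sf sm (fun κ u => cE • wilsonA d κ u) κ (t + v) = shiftK (-v) (unitS sf sm (fun κ u => cE • wilsonA d κ u) κ t) := by
  have h := wilsonA_translate (d := d) κ t v
  funext x z a b
  have hxz := congrFun (congrFun (congrFun (congrFun h x) z) a) b
  simp only [unitS_apply, Pi.smul_apply, smul_eq_mul, shiftK] at hxz ⊢
  rw [hxz]

/-- [folklore] **THE PAIR `(S^E_0, X̃♮_0)` IS ADMISSIBLE AT A COMMON POSITIVE RATE**: `∃ Cs CX m, 0 < m ∧ LocStencil S^E_0 Cs m ∧ Decays X̃♮_0 CX m` (the Wilson table is local at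
EVERY rate, `locStencil_wilsonA`; take the rate of the dressed step kernel). -/
theorem exists_common_rate0 (hr : r ∈ box (d + 1) Lc) (sf sm cE : ℝ) :
    ∃ Cs CX m : ℝ, 0 < m ∧ LocStencil (unitS sf sm (fun κ u => cE • wilsonA d κ u)) Cs m ∧ Decays (unitK sf sm (coDressKBmAt (toSite r) Lc (KInvStep (d := d) Lc 0))) CX m := by
  obtain ⟨δK, CK, hδK, -, hXd⟩ := decays_coDressKBmAt_KInvStep (d := d) hr 0
  have hV := locStencil_wilsonA (d := d) hδK.le
  have hVs := locStencil_unitS (sf := sf) (sm := sm) (locStencil_smul cE hV)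
  exact ⟨_, _, δK, hδK, hVs, decays_unitK (sf := sf) (sm := sm) hXd⟩

/-- [folklore] **`X̃♮_0` IS INVARIANT UNDER THE DEEP TRANSLATIONS `(Lc·N)•s`** (leaf-04's `shiftK_dressedStep` at `j = 0`, `t = N•s`). -/
theorem dressedStep_invariant_deep0 (sf sm : ℝ) (N : ℕ) (s : Site (d + 1)) :
    shiftK (-(((Lc * N : ℕ) : ℤ) • s)) (unitK sf sm (coDressKBmAt (toSite r) Lc (KInvStep (d := d) Lc 0))) =
      unitK sf sm (coDressKBmAt (toSite r) Lc (KInvStep (d := d) Lc 0)) := by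
  have hLc : 1 ≤ Lc := one_le_of_neZero Lc
  have hs : (((Lc * N : ℕ) : ℤ) • s) = (Lc : ℤ) • ((N : ℤ) • s) := by
    rw [Nat.cast_mul, mul_smul]
  rw [hs]
  exact shiftK_dressedStep (r := r) hLc sf sm 0 ((N : ℤ) • s)

/-! ## §2 The E⊗E face word of the level-`0` forcing at the deep period, valued from Part 45's output form -/

/-- NOT IN PRINT; OUR BOOKKEEPING.  **leaf-02 PART 45's OUTPUT WORD FOR THE LEVEL-`0` E SECTOR AT PERIOD `Lc·N`, VALUED** (module docstring; `μ ≠ α`, `ν ≠ β`). -/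
theorem faceWordEE_zero_value (hr : r ∈ box (d + 1) Lc) (sf sm cE : ℝ) (N : ℕ) [NeZero N] {μ α ν β : Fin (d + 1)} (hμα : μ ≠ α) (hνβ : ν ≠ β) :
    ∑ rr ∈ box (d + 1) (Lc * N), ∑' t : Site (d + 1),
        (if toSite rr μ % ((Lc * N : ℕ) : ℤ) = ((Lc * N : ℕ) : ℤ) - 1 then (1 : ℝ) else 0) * (if t ν % ((Lc * N : ℕ) : ℤ) = ((Lc * N : ℕ) : ℤ) - 1 then (1 : ℝ) else 0) *
        ∑' yw : Site (d + 1) × Site (d + 1),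
          (if yw.1 α % ((Lc * N : ℕ) : ℤ) = ((Lc * N : ℕ) : ℤ) - 1 then (1 : ℝ) else 0) * (if yw.2 β % ((Lc * N : ℕ) : ℤ) = ((Lc * N : ℕ) : ℤ) - 1 then (1 : ℝ) else 0) *
          comp (comp (unitS sf sm (fun κ u => cE • wilsonA d κ u) μ (toSite rr))
            (unitK sf sm (coDressKBmAt (toSite r) Lc (KInvStep (d := d) Lc 0))))
            (unitS sf sm (fun κ u => cE • wilsonA d κ u) ν t)
            yw.1 yw.2 (Sum.inl α) (Sum.inl β) =
      (((sf * sm)⁻¹ * (sf⁻¹ * sf⁻¹) * cE) * ((sf * sm)⁻¹ * (sf⁻¹ * sf⁻¹) * cE)) *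
      ((-(1 / 2 : ℝ)) * (1 / 2 : ℝ) * ((sf * sf) *
        ((wVH d Lc 0)⁻¹ *
            ∑ x ∈ box (d + 1) (Lc * N), ∑ b : Fin (d + 1),
              ((if b = μ then ((((Lc * N : ℕ) : ℝ))⁻¹ * (((Lc * N : ℕ) : ℝ))⁻¹) * ((((toSite x α % ((Lc * N : ℕ) : ℤ) : ℤ) : ℝ) - ((((Lc * N : ℕ) : ℝ)) - 1) / 2)) else 0)
                + (if b = α then (-(((Lc * N : ℕ) : ℝ))⁻¹ * ((((toSite x μ % ((Lc * N : ℕ) : ℤ) : ℤ) : ℝ) - ((((Lc * N : ℕ) : ℝ)) - 1) / 2))) *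
                    (if toSite x α % ((Lc * N : ℕ) : ℤ) = ((Lc * N : ℕ) : ℤ) - 1 then (1 : ℝ) else 0) else 0)) *
              ∑' s : Site (d + 1), ∑ b' : Fin (d + 1), E2 d Lc 0 (toSite x) s (Sum.inl b) (Sum.inl b') *
                ((if b' = ν then ((((Lc * N : ℕ) : ℝ))⁻¹ * (((Lc * N : ℕ) : ℝ))⁻¹) * ((((s β % ((Lc * N : ℕ) : ℤ) : ℤ) : ℝ) - ((((Lc * N : ℕ) : ℝ)) - 1) / 2)) else 0)
                  + (if b' = β then (-(((Lc * N : ℕ) : ℝ))⁻¹ * ((((s ν % ((Lc * N : ℕ) : ℤ) : ℤ) : ℝ) - ((((Lc * N : ℕ) : ℝ)) - 1) / 2))) *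
                      (if s β % ((Lc * N : ℕ) : ℤ) = ((Lc * N : ℕ) : ℤ) - 1 then (1 : ℝ) else 0) else 0)) -
          (wVH d Lc 0)⁻¹ * (((Lc : ℝ) ^ (d + 1) * (Lc : ℝ) ^ (d + 1)) *
            ∑ y ∈ box (d + 1) N, ∑ a : Fin (d + 1),
              ((if a = μ then (((N : ℝ))⁻¹ * ((N : ℝ))⁻¹) * ((((toSite y α % (N : ℤ)) : ℤ) : ℝ) - ((N : ℝ) - 1) / 2) else 0)
                + (if a = α then (-((N : ℝ))⁻¹ * ((((toSite y μ % (N : ℤ)) : ℤ) : ℝ) - ((N : ℝ) - 1) / 2)) *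
                    (if toSite y α % (N : ℤ) = (N : ℤ) - 1 then (1 : ℝ) else 0) else 0)) *
              ∑' s : Site (d + 1), ∑ b' : Fin (d + 1), E2 d Lc 1 (toSite y) s (Sum.inl a) (Sum.inl b') *
                ((if b' = ν then (((N : ℝ))⁻¹ * ((N : ℝ))⁻¹) * ((((s β % (N : ℤ)) : ℤ) : ℝ) - ((N : ℝ) - 1) / 2) else 0)
                  + (if b' = β then (-((N : ℝ))⁻¹ * ((((s ν % (N : ℤ)) : ℤ) : ℝ) - ((N : ℝ) - 1) / 2)) *
                      (if s β % (N : ℤ) = (N : ℤ) - 1 then (1 : ℝ) else 0) else 0)))))) := by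
  haveI : NeZero (Lc * N) := ⟨Nat.mul_ne_zero (NeZero.ne Lc) (NeZero.ne N)⟩
  obtain ⟨Cs, CX, m, hm, hS, hX⟩ := exists_common_rate0 (d := d) hr sf sm cE
  rw [faceWord_eq_cellPairing (N := Lc * N) hS hX hm
      (fun κ t s => sectorE0_translate (d := d) sf sm cE κ t (((Lc * N : ℕ) : ℤ) • s))
      (fun s => dressedStep_invariant_deep0 (r := r) sf sm N s)
      (fun κ t y x m b => sectorE0_inr_left (d := d) sf sm cE κ t y x m b)
      (fun κ t y x a m => sectorE0_inr_right (d := d) sf sm cE κ t y x a m) μ ν α β]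
  exact cellPairing_zero_value_units hr sf sm cE N hμα hνβ

/-- NOT IN PRINT; OUR BOOKKEEPING.  **THE DIRECT LEVEL-`0` E⊗E FACE WORD VANISHES FOR `ν = β`** (Part 45's output form). -/
theorem faceWordEE_zero_eq_zero_of_right_diag (hr : r ∈ box (d + 1) Lc) (sf sm cE : ℝ) (N : ℕ) [NeZero N] (μ α ν : Fin (d + 1)) :
    ∑ rr ∈ box (d + 1) (Lc * N), ∑' t : Site (d + 1),
        (if toSite rr μ % ((Lc * N : ℕ) : ℤ) = ((Lc * N : ℕ) : ℤ) - 1 then (1 : ℝ) else 0) * (if t ν % ((Lc * N : ℕ) : ℤ) = ((Lc * N : ℕ) : ℤ) - 1 then (1 : ℝ) else 0) *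
        ∑' yw : Site (d + 1) × Site (d + 1),
          (if yw.1 α % ((Lc * N : ℕ) : ℤ) = ((Lc * N : ℕ) : ℤ) - 1 then (1 : ℝ) else 0) * (if yw.2 ν % ((Lc * N : ℕ) : ℤ) = ((Lc * N : ℕ) : ℤ) - 1 then (1 : ℝ) else 0) *
          comp (comp (unitS sf sm (fun κ u => cE • wilsonA d κ u) μ (toSite rr))
            (unitK sf sm (coDressKBmAt (toSite r) Lc (KInvStep (d := d) Lc 0))))
            (unitS sf sm (fun κ u => cE • wilsonA d κ u) ν t)
            yw.1 yw.2 (Sum.inl α) (Sum.inl ν) = 0 := by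
  haveI : NeZero (Lc * N) := ⟨Nat.mul_ne_zero (NeZero.ne Lc) (NeZero.ne N)⟩
  obtain ⟨Cs, CX, m, hm, hS, hX⟩ := exists_common_rate0 (d := d) hr sf sm cE
  rw [faceWord_eq_cellPairing (N := Lc * N) hS hX hm
      (fun κ t s => sectorE0_translate (d := d) sf sm cE κ t (((Lc * N : ℕ) : ℤ) • s))
      (fun s => dressedStep_invariant_deep0 (r := r) sf sm N s)
      (fun κ t y x m b => sectorE0_inr_left (d := d) sf sm cE κ t y x m b)
      (fun κ t y x a m => sectorE0_inr_right (d := d) sf sm cE κ t y x a m) μ ν α ν]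
  exact cellPairing_zero_eq_zero_of_right_diag_units sf sm cE N μ α ν

/-- NOT IN PRINT; OUR BOOKKEEPING.  **THE DIRECT LEVEL-`0` E⊗E FACE WORD VANISHES FOR `μ = α`**. -/
theorem faceWordEE_zero_eq_zero_of_left_diag (hr : r ∈ box (d + 1) Lc) (sf sm cE : ℝ) (N : ℕ) [NeZero N] (μ ν β : Fin (d + 1)) :
    ∑ rr ∈ box (d + 1) (Lc * N), ∑' t : Site (d + 1),
        (if toSite rr μ % ((Lc * N : ℕ) : ℤ) = ((Lc * N : ℕ) : ℤ) - 1 then (1 : ℝ) else 0) * (if t ν % ((Lc * N : ℕ) : ℤ) = ((Lc * N : ℕ) : ℤ) - 1 then (1 : ℝ) else 0) *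
        ∑' yw : Site (d + 1) × Site (d + 1),
          (if yw.1 μ % ((Lc * N : ℕ) : ℤ) = ((Lc * N : ℕ) : ℤ) - 1 then (1 : ℝ) else 0) * (if yw.2 β % ((Lc * N : ℕ) : ℤ) = ((Lc * N : ℕ) : ℤ) - 1 then (1 : ℝ) else 0) *
          comp (comp (unitS sf sm (fun κ u => cE • wilsonA d κ u) μ (toSite rr))
            (unitK sf sm (coDressKBmAt (toSite r) Lc (KInvStep (d := d) Lc 0))))
            (unitS sf sm (fun κ u => cE • wilsonA d κ u) ν t)
            yw.1 yw.2 (Sum.inl μ) (Sum.inl β) = 0 := by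
  haveI : NeZero (Lc * N) := ⟨Nat.mul_ne_zero (NeZero.ne Lc) (NeZero.ne N)⟩
  obtain ⟨Cs, CX, m, hm, hS, hX⟩ := exists_common_rate0 (d := d) hr sf sm cE
  rw [faceWord_eq_cellPairing (N := Lc * N) hS hX hm
      (fun κ t s => sectorE0_translate (d := d) sf sm cE κ t (((Lc * N : ℕ) : ℤ) • s))
      (fun s => dressedStep_invariant_deep0 (r := r) sf sm N s)
      (fun κ t y x m b => sectorE0_inr_left (d := d) sf sm cE κ t y x m b)
      (fun κ t y x a m => sectorE0_inr_right (d := d) sf sm cE κ t y x a m) μ ν μ β]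
  exact cellPairing_zero_eq_zero_of_left_diag_units sf sm cE N μ ν β

end Summit.QuantumFields.BalabanUV.Beta.GAN24.FaceWordEEZero

end
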